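import Literature.Computability.AlgebraicComplexity.LMR13BoundaryFormNotCone
import Literature.Computability.AlgebraicComplexity.LMR13SubspaceVarietyProofs
import Literature.Computability.AlgebraicComplexity.LMR13SubspaceVarietyIrreducible
import HarnessLib

/-!
# Landsberg–Manivel–Ressayre 2013, Props. 3.5.1 and 4.1.1: what remains of the named facts
# after the proved companions (equivalences, PROVED)

Cell `val-lit` (D-0074), row `LMR13-A`, typer/prover `val-lit-t11` (g2). Theorem-only glue file
(no definitions, no named facts): the two named facts `LMR2013_prop_3_5_1` and `LMR2013_prop_4_1_1`
of `LMR13DualVarieties.lean` are shown EQUIVALENT to the conjunction of their clauses that are NOT yet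
proved in the tree, feeding in the proved companions by name —
`pLambda_mem_orbitClosure_detPoly`, `borderDc_pLambda` (`LMR13BoundaryOrbitProofs.lean`),
`not_orbitClosure_pLambda_subset_endOrbit`, `lt_determinantalComplexity_pLambda`,
`orbitClosure_pLambda_subset_orbitClosure_detPoly`, `orbitClosure_pLambda_isCoeffZariskiIrreducible`
(`LMR13BoundaryFormNotCone.lean`), `subspaceVariety_subset_lmrDualScheme`
(`LMR13SubspaceVarietyProofs.lean`), `subspaceVariety_isCoeffZariskiIrreducible`
(`LMR13SubspaceVarietyIrreducible.lean`) — in the style of `LMR2013_thm_3_1_1_iff`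
(`LMR13ZariskiTangentProofs.lean`). This is bookkeeping for the cell's census (which clauses of a
fact consumed as a whole are genuinely open in the tree); the facts stay `def`s.

What remains, exactly. Prop. 3.5.1 (`n` odd, `n ≥ 3`): (b′) `Δ(P_Λ)` is disjoint from the orbit
`GL(W)·det_n` (only the disjointness of the two ORBITS is proved, `disjoint_glOrbit_pLambda_glOrbit_detPoly`;
the closure statement needs "orbits are open in their closure"), (b″) maximality of `Δ(P_Λ)` among the
irreducible subsets of the boundary `Δ(det_n) ∖ GL(W)·det_n`, and (c) the codimension-one equation.
Prop. 4.1.1 (`d ≥ 3`, `κ + 3 ≤ N`): maximality of `Sub_{κ+2}(S^dW^*)` among the irreducible subsets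
of `𝒟ual_{κ,d,N}`, and the reducedness clause (ii).

Honest framing: elementary repackaging of a 2013 paper's statements; **VP ≠ VNP is NOT proved and
nothing here is progress on it.**

## References

* [LandsbergManivelRessayre2013] J. M. Landsberg, L. Manivel, N. Ressayre, *Hypersurfaces with
  degenerate duals and the Geometric Complexity Theory Program*, Comment. Math. Helv. 88 (2013)
  469–484, Props. 3.5.1 (p. 481) and 4.1.1 (p. 482); arXiv:1004.4802.
* [Hartshorne1977] R. Hartshorne, *Algebraic Geometry*, Springer 1977, I §1 Cor. 1.6 (irreducible
  components).
-/

namespace Literature.Computability.AlgebraicComplexity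

open MvPolynomial

section Boundary

/-- **LMR 2013, Prop. 3.5.1 — what remains.** With conjuncts (a) `P_Λ ∈ Δ(det_n)`, (d)
`Δ(P_Λ) ⊄ End(W)·det_n`, (e) `\overline{dc}(P_{Λ,n}) = n`, (f) `n < dc(P_{Λ,n})`, the inclusion
`Δ(P_Λ) ⊆ Δ(det_n)` and the irreducibility of `Δ(P_Λ)` PROVED (companions), the named fact
`LMR2013_prop_3_5_1` is EQUIVALENT to: for every odd `n ≥ 3`, `Δ(P_Λ)` misses the orbit `GL(W)·det_n`,
`Δ(P_Λ)` is maximal among the irreducible subsets of the boundary `Δ(det_n) ∖ GL(W)·det_n`, and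
`dim Δ(P_Λ) + 1 = dim Δ(det_n)` (cones in degree-`n` coefficient space) — i.e. exactly the printed
"irreducible codimension one component of the boundary" content.
[cite: LandsbergManivelRessayre2013, Proposition 3.5.1 (p. 481)] -/
theorem LMR2013_prop_3_5_1_iff :
    LMR2013_prop_3_5_1 ↔ ∀ n : ℕ, Odd n → 3 ≤ n →
      Disjoint (orbitClosure (pLambda n)) (glOrbit (Fin n × Fin n) ℂ (detPoly (Fin n) ℂ)) ∧
      (∀ S' : Set (MvPolynomial (Fin n × Fin n) ℂ), IsCoeffZariskiIrreducible S' →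
        orbitClosure (pLambda n) ⊆ S' →
          S' ⊆ orbitClosure (detPoly (Fin n) ℂ) \ glOrbit (Fin n × Fin n) ℂ (detPoly (Fin n) ℂ) →
            S' ⊆ orbitClosure (pLambda n)) ∧
      affineDimension (formCoeff n '' orbitClosure (pLambda n)) + 1 =
        affineDimension (formCoeff n '' orbitClosure (detPoly (Fin n) ℂ)) := by
  refine forall₃_congr fun n hn h3 => ?_
  have ha := pLambda_mem_orbitClosure_detPoly hn
  have hd := not_orbitClosure_pLambda_subset_endOrbit hn h3
  have he := borderDc_pLambda hn
  have hf := lt_determinantalComplexity_pLambda hn h3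
  have hsub := orbitClosure_pLambda_subset_orbitClosure_detPoly hn
  have hirr := orbitClosure_pLambda_isCoeffZariskiIrreducible hn
  have hdisj : Disjoint (orbitClosure (pLambda n)) (glOrbit (Fin n × Fin n) ℂ (detPoly (Fin n) ℂ)) ↔
      orbitClosure (pLambda n) ⊆
        orbitClosure (detPoly (Fin n) ℂ) \ glOrbit (Fin n × Fin n) ℂ (detPoly (Fin n) ℂ) := by
    rw [Set.subset_sdiff, and_iff_right hsub]
  constructor
  · rintro ⟨-, hb, hc, -, -, -⟩
    exact ⟨hdisj.mpr hb.1, hb.2.2, hc⟩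
  · rintro ⟨hb1, hb2, hc⟩
    exact ⟨ha, ⟨hdisj.mp hb1, hirr, hb2⟩, hc, hd, he, hf⟩

end Boundary

section Subspace

variable {σ : Type*} [Fintype σ] [DecidableEq σ]

/-- **LMR 2013, Prop. 4.1.1 — what remains.** With `Sub_{κ+2}(S^dW^*) ⊆ 𝒟ual_{κ,d,N}`
(`subspaceVariety_subset_lmrDualScheme`) and the irreducibility of `Sub_{κ+2}(S^dW^*)`
(`subspaceVariety_isCoeffZariskiIrreducible`) PROVED, the named fact `LMR2013_prop_4_1_1` is
EQUIVALENT to: for all `d ≥ 3`, `κ + 3 ≤ N`, `Sub_{κ+2}` is maximal among the irreducible subsets of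
`𝒟ual_{κ,d,N}` ("is an irreducible component") and the reducedness clause (ii) as typed.
[cite: LandsbergManivelRessayre2013, Proposition 4.1.1 (p. 482)] -/
theorem LMR2013_prop_4_1_1_iff :
    LMR2013_prop_4_1_1 (σ := σ) ↔ ∀ κ d : ℕ, 3 ≤ d → κ + 3 ≤ Fintype.card σ →
      (∀ S' : Set (MvPolynomial σ ℂ), IsCoeffZariskiIrreducible S' →
        subspaceVariety σ ℂ (κ + 2) d ⊆ S' → S' ⊆ lmrDualScheme κ d →
          S' ⊆ subspaceVariety σ ℂ (κ + 2) d) ∧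
      ∃ g : MvPolynomial (σ →₀ ℕ) ℂ,
        (∃ P ∈ subspaceVariety σ ℂ (κ + 2) d, aeval (coeffVec P) g ≠ 0) ∧
        ∀ (L : Fin (κ + 2) → MvPolynomial σ ℂ) (Q : MvPolynomial (Fin (κ + 2)) ℂ),
          (∀ a, (L a).IsHomogeneous 1) → LinearIndependent ℂ L → Q.IsHomogeneous d →
            aeval (coeffVec (aeval L Q)) g ≠ 0 →
              lmrZariskiTangent κ d (aeval L Q) ⊆ subspaceTangent (κ + 2) d L Q := by
  refine forall₂_congr fun κ d => forall₂_congr fun hd hκ => ?_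
  rw [isCoeffIrreducibleComponent_iff_of_irreducible (subspaceVariety_subset_lmrDualScheme κ d)
    (subspaceVariety_isCoeffZariskiIrreducible (κ + 2) d)]

end Subspace

end Literature.Computability.AlgebraicComplexity
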